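import Summits.CriticalPhenomena.Ising3DConformalLimit.Theorems.EnergyNotSigmaSquaredGapForcesFarMergingSandwichMeetDominationAuxReroot
import Summits.CriticalPhenomena.Ising3DConformalLimit.Theorems.EnergyNotSigmaSquaredGapForcesFarMergingSandwichMeetDominationAuxFirstMoment
import HarnessLib

/-!
# The exact `1/N` re-rooting identity for the annulus meeting of the one-pinch system, and the reduction of
# meet domination to a domination of the re-rooted terms
# (line `one-cluster-depletion-sandwich` of crux `GapForcesFarMerging`, item stmt-CriticalPhenomena-4468;
# helper file for the registered stub `stub_meetDomination`)

For the four-trace law `fourTraceLaw n y` (two INDEPENDENT duplicated clusters `C₁ = C_{n₁+n₂}(y₀)`, `C₂ = C_{n₃+n₄}(y₂)`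
of the free box `Λ_n ⊂ ℤ³` at `β_c`) and a finite `A ⊆ Λ_n`:
* `real_meetSet_eq_sum_reroot` (EXACT): `P[C₁ ∩ C₂ ∩ A ≠ ∅] = ∑_{v ∈ A} ρ_n(y₀,y₁;v) ρ_n(y₂,y₃;v)·E^{rr(v)}[1/N_A(v)]`,
  the re-rooted law at `v` being the product `P^{y₁v,y₀v}_{Λ_n} ⊗ P^{y₃v,y₂v}_{Λ_n}` of FOUR independent sourced currents
  through `v` read on the two traces, `N_A(v) = #(C₁(v) ∩ C₂(v) ∩ A) ≥ 1`, `ρ_n(a,b;v) = G_n(a,v)G_n(v,b)/G_n(a,b)`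
  (pointwise `𝟙[meet in A] = ∑_{v∈A} 𝟙[v ∈ C₁ ∩ C₂]/#(C₁∩C₂∩A)`, integrated with the change of measure
  `reroot_restrict`; Aizenman–Duminil-Copin 2021 §4.1: `P[0<|𝒯|<m] ≤ ∑_u ρρ(u)·P^{ux,uz,uy,ut}[…]`), and its one-pinch
  form `meetAnn_eq_sum_reroot` (registered: `meetDomination_rerootIdentity`, last theorem);
* `meetDomination_of_rerootDomination` (REDUCTION, bookkeeping only): the SAME identity computes the meeting of a fresh
  dilated shape `2^j • y` inside any `A`; hence `MeetDomination` — in the corrected form carrying the doubling hypothesis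
  `Doubling θ k` at the octave `k` itself — follows from a domination, over a cover of the annulus by at most `M` pieces
  `A`, of the re-rooted sums `∑_{v∈A} ρρ_{pinch}(v)·E^{rr_pinch(v)}[1/N_A(v)] ≤ C·∑_{v∈A} ρρ_{2^jy}(v)·E^{rr_{2^jy}(v)}[1/N_A(v)]`
  (the hypothesis; it is the conjunction of a two-point comparison of the exact densities — which needs regularity of
  `G` at scale `2^k`, ADC21 Assumption 4.1 / §5.6 — and the open relocation statement for the law of four independent
  sourced currents through `v` tested on the decreasing functional `1/N_A(v)`; ADC21 §6 / Panis arXiv:2406.15243 §5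
  prove only an ADDITIVE mixing version at regular scales).
Everything is proved; no definition and no named fact is introduced.

References: M. Aizenman, H. Duminil-Copin, Ann. of Math. 194 (2021) = arXiv:1912.07973, §4.1–4.2, §5.6, §6
[AizenmanDuminilCopinAnnals2021].
-/

noncomputable section

namespace Summit.CriticalPhenomena.Ising3DConformalLimit.EnergyNotSigmaSquaredGapForcesFarMergingSandwich

namespace MeetDominationProof

open scoped symmDiff ENNReal Topology
open MeasureTheory Filter
open Literature.Probability.LatticeModels Literature.Probability.Percolation
open Summit.CriticalPhenomena.Ising3DConformalLimit.GapForcesFarMergingSandwich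
open Summit.CriticalPhenomena.Ising3DConformalLimit.Cruxes.IsingEuclidUpgradeR4NonGaussian.FreeCovarianceDeltaDichotomy
  (boxG threePointRatio)

/-! ## §1. The exact `1/N` identity -/

open Classical in
/-- **The `1/N` identity (exact)**: for a quadruple `y ⊂ Λ_n` and a finite `A ⊆ Λ_n`, the probability that the two
duplicated clusters share a vertex of `A` is
`P[C₁(y₀) ∩ C₂(y₂) ∩ A ≠ ∅] = ∑_{v ∈ A} ρ_n(y₀,y₁;v) ρ_n(y₂,y₃;v) · E^{rr(v)}[1/N_A(v)]`,
`N_A(v) = #(C₁(v) ∩ C₂(v) ∩ A) ≥ 1` the local intersection count of the RE-ROOTED system `P^{y₁v,y₀v} ⊗ P^{y₃v,y₂v}` (four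
independent sourced currents through `v`): `𝟙[meet in A] = ∑_{v ∈ A} 𝟙[v ∈ C₁ ∩ C₂]/N_A` pointwise, then re-root each
term (Aizenman–Duminil-Copin 2021, §4.1–4.2: the step `P[𝒯 ≠ ∅] = ∑_u P[u ∈ 𝒯]·E[1/|𝒯| ∣ u ∈ 𝒯]` behind Lemma 4.4).
[cite: AizenmanDuminilCopinAnnals2021, §4.1–4.2, proof of Thm 1.3 and Lemma 4.4] -/
theorem real_meetSet_eq_sum_reroot {n : ℕ} {y : Fin 4 → Site 3} (hy : ∀ i, y i ∈ box 3 n)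
    {A : Finset (Site 3)} (hA : A ⊆ box 3 n) :
    (fourTraceLaw n y).real {ω | ∃ u ∈ A, u ∈ openCluster ω.1 (y 0) ∧ u ∈ openCluster ω.2 (y 2)} =
      ∑ v ∈ A, threePointRatio n (y 0) (y 1) v * threePointRatio n (y 2) (y 3) v *
        ∫ ω, (((A.filter fun u => u ∈ openCluster ω.1 v ∧ u ∈ openCluster ω.2 v).card : ℕ) : ℝ)⁻¹
          ∂((sourcedDoubleCurrentLaw 3 n βc ({y 1} ∆ {v}) ({y 0} ∆ {v})).prod
            (sourcedDoubleCurrentLaw 3 n βc ({y 3} ∆ {v}) ({y 2} ∆ {v}))) := by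
  haveI : IsProbabilityMeasure (fourTraceLaw n y) := TailTightnessProof.isProbabilityMeasure_fourTraceLaw hy
  set μ := fourTraceLaw n y with hμdef
  -- the rectangles `F v = {v ∈ C₁(y₀)} × {v ∈ C₂(y₂)}` and the count `N = #(C₁(y₀) ∩ C₂(y₂) ∩ A)`
  set F : Site 3 → Set (BondConfig (Site 3) × BondConfig (Site 3)) := fun v =>
    {ω | ω.1 ∈ openConn (y 0) v ∧ ω.2 ∈ openConn (y 2) v} with hFdef
  have hFmeas : ∀ v, MeasurableSet (F v) := fun v =>
    (measurableSet_openConn_holds (y 0) v).prod (measurableSet_openConn_holds (y 2) v)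
  set N : BondConfig (Site 3) × BondConfig (Site 3) → ℝ := fun ω =>
    (((A.filter fun u => u ∈ openCluster ω.1 (y 0) ∧ u ∈ openCluster ω.2 (y 2)).card : ℕ) : ℝ) with hNdef
  have hN : ∀ ω, N ω = ∑ u ∈ A, (F u).indicator 1 ω := by
    intro ω
    rw [hNdef]
    dsimp only
    rw [Finset.natCast_card_filter]
    refine Finset.sum_congr rfl fun u _ => ?_
    by_cases h : u ∈ openCluster ω.1 (y 0) ∧ u ∈ openCluster ω.2 (y 2)
    · rw [if_pos h, Set.indicator_of_mem (show ω ∈ F u from h), Pi.one_apply]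
    · rw [if_neg h, Set.indicator_of_notMem (show ω ∉ F u from h)]
  have hNmeas : Measurable N := by
    rw [show N = fun ω => ∑ u ∈ A, (F u).indicator 1 ω from funext hN]
    exact Finset.measurable_sum _ fun u _ => measurable_one.indicator (hFmeas u)
  have hNinv_le : ∀ ω, (N ω)⁻¹ ≤ 1 := by
    intro ω
    rw [hNdef]
    dsimp only
    rcases Nat.eq_zero_or_pos ((A.filter fun u => u ∈ openCluster ω.1 (y 0) ∧ u ∈ openCluster ω.2 (y 2)).card)
      with h | h
    · rw [h, Nat.cast_zero, inv_zero]; exact zero_le_one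
    · exact inv_le_one_of_one_le₀ (by exact_mod_cast h)
  have hNinv_nn : ∀ ω, 0 ≤ (N ω)⁻¹ := fun ω => inv_nonneg.2 (Nat.cast_nonneg _)
  -- the meeting event and the pointwise identity `𝟙[meet in A] = ∑_v 𝟙[F v] / N`
  set M : Set (BondConfig (Site 3) × BondConfig (Site 3)) :=
    {ω | ∃ u ∈ A, u ∈ openCluster ω.1 (y 0) ∧ u ∈ openCluster ω.2 (y 2)} with hMdef
  have hMeq : M = ⋃ u ∈ A, F u := by
    ext ω
    simp only [hMdef, Set.mem_setOf_eq, Set.mem_iUnion, exists_prop]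
    rfl
  have hMmeas : MeasurableSet M := by
    rw [hMeq]
    exact MeasurableSet.biUnion A.countable_toSet fun u _ => hFmeas u
  have hpt : ∀ ω, M.indicator (1 : BondConfig (Site 3) × BondConfig (Site 3) → ℝ) ω =
      ∑ v ∈ A, (F v).indicator 1 ω * (N ω)⁻¹ := by
    intro ω
    rw [← Finset.sum_mul, ← hN ω]
    by_cases hω : ω ∈ M
    · obtain ⟨u, huA, hu⟩ := hω
      have hN0 : N ω ≠ 0 := by
        rw [hNdef]
        dsimp only
        exact Nat.cast_ne_zero.2 (Finset.card_ne_zero.2 ⟨u, Finset.mem_filter.2 ⟨huA, hu⟩⟩)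
      rw [Set.indicator_of_mem (show ω ∈ M from ⟨u, huA, hu⟩), Pi.one_apply, mul_inv_cancel₀ hN0]
    · have hN0 : N ω = 0 := by
        rw [hNdef]
        dsimp only
        rw [Nat.cast_eq_zero, Finset.card_eq_zero, Finset.filter_eq_empty_iff]
        exact fun u huA hu => hω ⟨u, huA, hu⟩
      rw [Set.indicator_of_notMem hω, hN0, zero_mul]
  -- integrate
  have hint : ∀ v ∈ A, Integrable (fun ω => (F v).indicator 1 ω * (N ω)⁻¹) μ := by
    intro v _
    refine Integrable.of_bound (((measurable_one.indicator (hFmeas v)).mul hNmeas.inv).aestronglyMeasurable) 1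
      (ae_of_all _ fun ω => ?_)
    have hind : (F v).indicator (1 : BondConfig (Site 3) × BondConfig (Site 3) → ℝ) ω ≤ 1 ∧
        0 ≤ (F v).indicator (1 : BondConfig (Site 3) × BondConfig (Site 3) → ℝ) ω := by
      by_cases h : ω ∈ F v
      · rw [Set.indicator_of_mem h, Pi.one_apply]; exact ⟨le_rfl, zero_le_one⟩
      · rw [Set.indicator_of_notMem h]; exact ⟨zero_le_one, le_rfl⟩
    rw [Real.norm_eq_abs, abs_of_nonneg (mul_nonneg hind.2 (hNinv_nn ω))]
    exact mul_le_one₀ hind.1 (hNinv_nn ω) (hNinv_le ω)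
  calc μ.real M = ∫ ω, M.indicator 1 ω ∂μ := (integral_indicator_one hMmeas).symm
    _ = ∫ ω, ∑ v ∈ A, (F v).indicator 1 ω * (N ω)⁻¹ ∂μ := by simp_rw [hpt]
    _ = ∑ v ∈ A, ∫ ω, (F v).indicator 1 ω * (N ω)⁻¹ ∂μ := integral_finsetSum A hint
    _ = ∑ v ∈ A, ∫ ω in F v, (N ω)⁻¹ ∂μ := by
        refine Finset.sum_congr rfl fun v _ => ?_
        rw [← integral_indicator (hFmeas v)]
        refine integral_congr_ae (ae_of_all _ fun ω => ?_)
        by_cases h : ω ∈ F v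
        · simp only [Set.indicator_of_mem h, Pi.one_apply, one_mul]
        · simp only [Set.indicator_of_notMem h, zero_mul]
    _ = _ := by
        refine Finset.sum_congr rfl fun v hv => ?_
        have hvb : v ∈ box 3 n := hA hv
        haveI := isProbabilityMeasure_law₂ (hy 1) hvb (hy 0) hvb
        haveI := isProbabilityMeasure_law₂ (hy 3) hvb (hy 2) hvb
        rw [hμdef, reroot_restrict hy hvb, integral_smul_measure, ENNReal.toReal_ofReal (mul_pos
          (threePointRatio_pos (hy 0) (hy 1) hvb) (threePointRatio_pos (hy 2) (hy 3) hvb)).le, smul_eq_mul]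
        congr 1
        -- re-base the count at `v`: a.s. `C₁(y₀) = C₁(v)` and `C₂(y₂) = C₂(v)`
        refine integral_congr_ae ?_
        have hae : ∀ᵐ ω ∂((sourcedDoubleCurrentLaw 3 n βc ({y 1} ∆ {v}) ({y 0} ∆ {v})).prod
            (sourcedDoubleCurrentLaw 3 n βc ({y 3} ∆ {v}) ({y 2} ∆ {v}))), ω ∈ F v := by
          rw [ae_iff]
          exact reroot_compl_null hy hvb
        filter_upwards [hae] with ω hω
        rw [hNdef]
        dsimp only
        congr 3
        ext u
        simp only [Finset.mem_filter, and_congr_right_iff]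
        intro _
        have h1 : (openGraph ω.1).Reachable (y 0) v := hω.1
        have h2 : (openGraph ω.2).Reachable (y 2) v := hω.2
        exact Iff.and ⟨fun h => h1.symm.trans h, fun h => h1.trans h⟩ ⟨fun h => h2.symm.trans h, fun h => h2.trans h⟩

/-! ## §2. The one-pinch system -/

open Classical in
/-- **The `1/N` identity for the one-pinch system** (exact): for `2^k, 2^K ≤ n`,
`meetAnn n k K = ∑_{v ∈ Λ_{2^k}∖Λ_{2^{k-1}}} ρ_n(0,p_K;v) ρ_n(e₂,q_K;v) · E^{rr(v)}[1/N_k(v)]`, where the re-rooted law at `v` is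
the product `P^{p_K v, 0v}_{Λ_n} ⊗ P^{q_K v, e₂v}_{Λ_n}` of FOUR independent sourced currents through `v` (`v → p_K`, `0 → v`,
`v → q_K`, `e₂ → v`) read on the two traces, and `N_k(v) = #(C₁(v) ∩ C₂(v) ∩ (Λ_{2^k}∖Λ_{2^{k-1}})) ≥ 1`.
[cite: AizenmanDuminilCopinAnnals2021, §4.1–4.2, proof of Thm 1.3 and Lemma 4.4] -/
theorem meetAnn_eq_sum_reroot {n k K : ℕ} (hk : 2 ^ k ≤ n) (hK : 2 ^ K ≤ n) :
    meetAnn n k K = ∑ v ∈ box 3 (2 ^ k) \ box 3 (2 ^ (k - 1)),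
      threePointRatio n 0 (pFar K) v * threePointRatio n e₂ (qFar K) v *
        ∫ ω, ((((box 3 (2 ^ k) \ box 3 (2 ^ (k - 1))).filter
            fun u => u ∈ openCluster ω.1 v ∧ u ∈ openCluster ω.2 v).card : ℕ) : ℝ)⁻¹
          ∂((sourcedDoubleCurrentLaw 3 n βc ({pFar K} ∆ {v}) ({0} ∆ {v})).prod
            (sourcedDoubleCurrentLaw 3 n βc ({qFar K} ∆ {v}) ({e₂} ∆ {v}))) :=
  real_meetSet_eq_sum_reroot (pinch_mem_box hK) (ann_subset_box hk)

/-! ## §3. Counting-set bookkeeping -/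

/-- A nonnegative sum over a covered set is at most the sum of the sums over the covering pieces. [folklore] -/
theorem sum_le_sum_sum_of_cover {ι : Type*} [DecidableEq ι] (S : Finset ι) (P : Finset (Finset ι)) (f : ι → ℝ)
    (hf : ∀ v ∈ S, 0 ≤ f v) (hcover : ∀ v ∈ S, ∃ A ∈ P, v ∈ A) (hsub : ∀ A ∈ P, A ⊆ S) :
    ∑ v ∈ S, f v ≤ ∑ A ∈ P, ∑ v ∈ A, f v := by
  have h1 : ∀ A ∈ P, ∑ v ∈ A, f v = ∑ v ∈ S, if v ∈ A then f v else 0 := fun A hA => by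
    rw [← Finset.sum_filter]
    congr 1
    ext v
    simp only [Finset.mem_filter]
    exact ⟨fun hv => ⟨hsub A hA hv, hv⟩, fun hv => hv.2⟩
  rw [Finset.sum_congr rfl h1, Finset.sum_comm]
  refine Finset.sum_le_sum fun v hv => ?_
  obtain ⟨A, hA, hvA⟩ := hcover v hv
  calc f v = if v ∈ A then f v else 0 := by rw [if_pos hvA]
    _ ≤ ∑ B ∈ P, if v ∈ B then f v else 0 :=
        Finset.single_le_sum (f := fun B => if v ∈ B then f v else 0) (fun B _ => ite_nonneg (hf v hv) le_rfl) hA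

open Classical in
/-- The local intersection count `#(C₁(x) ∩ C₂(z) ∩ A)` as a sum of indicators of rectangles of connection events. [folklore] -/
theorem card_filter_eq_sum_indicator (A : Finset (Site 3)) (x z : Site 3) (ω : BondConfig (Site 3) × BondConfig (Site 3)) :
    (((A.filter fun u => u ∈ openCluster ω.1 x ∧ u ∈ openCluster ω.2 z).card : ℕ) : ℝ) =
      ∑ u ∈ A, {ω' : BondConfig (Site 3) × BondConfig (Site 3) | ω'.1 ∈ openConn x u ∧ ω'.2 ∈ openConn z u}.indicator 1 ω := by
  rw [Finset.natCast_card_filter]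
  refine Finset.sum_congr rfl fun u _ => ?_
  by_cases h : u ∈ openCluster ω.1 x ∧ u ∈ openCluster ω.2 z
  · rw [if_pos h, Set.indicator_of_mem (show ω ∈ {ω' : BondConfig (Site 3) × BondConfig (Site 3) |
      ω'.1 ∈ openConn x u ∧ ω'.2 ∈ openConn z u} from h), Pi.one_apply]
  · rw [if_neg h, Set.indicator_of_notMem (show ω ∉ {ω' : BondConfig (Site 3) × BondConfig (Site 3) |
      ω'.1 ∈ openConn x u ∧ ω'.2 ∈ openConn z u} from h)]

open Classical in
/-- The inverse local intersection count is measurable. [folklore] -/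
theorem measurable_invCount (A : Finset (Site 3)) (x z : Site 3) :
    Measurable fun ω : BondConfig (Site 3) × BondConfig (Site 3) =>
      (((A.filter fun u => u ∈ openCluster ω.1 x ∧ u ∈ openCluster ω.2 z).card : ℕ) : ℝ)⁻¹ := by
  refine Measurable.inv ?_
  rw [show (fun ω : BondConfig (Site 3) × BondConfig (Site 3) =>
      (((A.filter fun u => u ∈ openCluster ω.1 x ∧ u ∈ openCluster ω.2 z).card : ℕ) : ℝ)) = fun ω =>
      ∑ u ∈ A, {ω' : BondConfig (Site 3) × BondConfig (Site 3) | ω'.1 ∈ openConn x u ∧ ω'.2 ∈ openConn z u}.indicator 1 ω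
    from funext (card_filter_eq_sum_indicator A x z)]
  exact Finset.measurable_sum _ fun u _ =>
    measurable_one.indicator ((measurableSet_openConn_holds x u).prod (measurableSet_openConn_holds z u))

open Classical in
/-- The inverse local intersection count lies in `[0,1]`. [folklore] -/
theorem invCount_mem_Icc (A : Finset (Site 3)) (x z : Site 3) (ω : BondConfig (Site 3) × BondConfig (Site 3)) :
    0 ≤ (((A.filter fun u => u ∈ openCluster ω.1 x ∧ u ∈ openCluster ω.2 z).card : ℕ) : ℝ)⁻¹ ∧
      (((A.filter fun u => u ∈ openCluster ω.1 x ∧ u ∈ openCluster ω.2 z).card : ℕ) : ℝ)⁻¹ ≤ 1 := by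
  refine ⟨inv_nonneg.2 (Nat.cast_nonneg _), ?_⟩
  rcases Nat.eq_zero_or_pos ((A.filter fun u => u ∈ openCluster ω.1 x ∧ u ∈ openCluster ω.2 z).card) with h | h
  · rw [h, Nat.cast_zero, inv_zero]; exact zero_le_one
  · exact inv_le_one_of_one_le₀ (by exact_mod_cast h)

open Classical in
/-- The inverse local intersection count is integrable against any finite measure. [folklore] -/
theorem integrable_invCount (A : Finset (Site 3)) (x z : Site 3) (μ : Measure (BondConfig (Site 3) × BondConfig (Site 3)))
    [IsFiniteMeasure μ] :
    Integrable (fun ω : BondConfig (Site 3) × BondConfig (Site 3) =>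
      (((A.filter fun u => u ∈ openCluster ω.1 x ∧ u ∈ openCluster ω.2 z).card : ℕ) : ℝ)⁻¹) μ := by
  refine Integrable.of_bound (measurable_invCount A x z).aestronglyMeasurable 1 (ae_of_all _ fun ω => ?_)
  rw [Real.norm_eq_abs, abs_of_nonneg (invCount_mem_Icc A x z ω).1]
  exact (invCount_mem_Icc A x z ω).2

open Classical in
/-- **Monotonicity of the re-rooted term in the counting set**: for `v ∈ A ⊆ B`, `E[1/N_B(v)] ≤ E[1/N_A(v)]` under any
finite measure (`1 ≤ N_A(v) ≤ N_B(v)` pointwise, `v` lying in its own clusters). [folklore] -/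
theorem integral_invCount_anti {A B : Finset (Site 3)} (hAB : A ⊆ B) {v : Site 3} (hv : v ∈ A)
    (μ : Measure (BondConfig (Site 3) × BondConfig (Site 3))) [IsFiniteMeasure μ] :
    ∫ ω, (((B.filter fun u => u ∈ openCluster ω.1 v ∧ u ∈ openCluster ω.2 v).card : ℕ) : ℝ)⁻¹ ∂μ ≤
      ∫ ω, (((A.filter fun u => u ∈ openCluster ω.1 v ∧ u ∈ openCluster ω.2 v).card : ℕ) : ℝ)⁻¹ ∂μ := by
  refine integral_mono (integrable_invCount B v v μ) (integrable_invCount A v v μ) fun ω => ?_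
  have hmem : v ∈ A.filter (fun u => u ∈ openCluster ω.1 v ∧ u ∈ openCluster ω.2 v) :=
    Finset.mem_filter.2 ⟨hv, mem_openCluster_self _ _, mem_openCluster_self _ _⟩
  have hpos : (0 : ℝ) < ((A.filter fun u => u ∈ openCluster ω.1 v ∧ u ∈ openCluster ω.2 v).card : ℕ) :=
    Nat.cast_pos.2 (Finset.card_pos.2 ⟨v, hmem⟩)
  have hle : (((A.filter fun u => u ∈ openCluster ω.1 v ∧ u ∈ openCluster ω.2 v).card : ℕ) : ℝ) ≤
      ((B.filter fun u => u ∈ openCluster ω.1 v ∧ u ∈ openCluster ω.2 v).card : ℕ) :=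
    Nat.cast_le.2 (Finset.card_le_card (Finset.filter_subset_filter _ hAB))
  exact inv_anti₀ hpos hle

/-- The annulus `Λ_{2^k} ∖ Λ_{2^{k-1}}` is nonempty for `k ≥ 1` (it contains `2^k e₁`). [folklore] -/
theorem ann_nonempty {k : ℕ} (hk : 1 ≤ k) : (box 3 (2 ^ k) \ box 3 (2 ^ (k - 1))).Nonempty := by
  have hlt : (2 : ℤ) ^ (k - 1) < 2 ^ k := pow_lt_pow_right₀ (by norm_num) (by omega)
  have h2 : (0 : ℤ) ≤ 2 ^ k := by positivity
  refine ⟨fun i => if i = 0 then 2 ^ k else 0, Finset.mem_sdiff.2 ⟨?_, fun h => ?_⟩⟩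
  · rw [mem_box]; intro i
    split_ifs <;> constructor <;> push_cast <;> linarith
  · have h0 := (mem_box.1 h 0).2
    rw [if_pos rfl] at h0
    push_cast at h0
    linarith

/-! ## §4. The reduction: meet domination from a domination of the re-rooted terms -/

open Classical in
/-- **Reduction of meet domination to a domination of the re-rooted terms.** Suppose that for every doubling octave
`k` (of a doubling far octave `K`) the annulus `Λ_{2^k}∖Λ_{2^{k-1}}` is covered by at most `M` pieces `A`, each carrying
a fresh injective shape `y_A ∈ (Λ_M)⁴` and a scale `j_A ∈ [k-k₁, k+2]` such that, eventually in `n`, the sum over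
`v ∈ A` of the pinch system's re-rooted terms `ρ_n(0,p_K;v)ρ_n(e₂,q_K;v)·E^{rr(v)}[1/N_A(v)]` is at most `C` times the
same sum for the dilated shape `2^{j_A} y_A` (a per-site domination is the special case). Then (the exact identity `real_meetSet_eq_sum_reroot` applied to both systems)
`meetAnn n k K ≤ C·M·c` whenever every such dilated shape has duplicated hitting `≤ c`: MEET DOMINATION at doubling
octaves, with `ε = 0`. [cite: AizenmanDuminilCopinAnnals2021, §4.1, proof of Thm 1.3 (switching step)] -/
theorem meetDomination_of_rerootDomination
    (hRD : ∀ θ : ℝ, 0 < θ → ∃ M k₁ : ℕ, ∃ C : ℝ, ∀ k K : ℕ, 1 ≤ k → k ≤ 5 * K + 3 → Doubling θ K → Doubling θ k →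
      ∃ P : Finset (Finset (Site 3)), P.card ≤ M ∧
        (∀ v ∈ box 3 (2 ^ k) \ box 3 (2 ^ (k - 1)), ∃ A ∈ P, v ∈ A) ∧
        (∀ A ∈ P, A ⊆ box 3 (2 ^ k) \ box 3 (2 ^ (k - 1))) ∧
        ∀ A ∈ P, ∃ y : Fin 4 → Site 3, Function.Injective y ∧ (∀ i, y i ∈ box 3 M) ∧
          ∃ j : ℕ, k ≤ j + k₁ ∧ j ≤ k + 2 ∧ ∀ᶠ n : ℕ in atTop,
            ∑ v ∈ A, threePointRatio n 0 (pFar K) v * threePointRatio n e₂ (qFar K) v *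
                ∫ ω, (((A.filter fun u => u ∈ openCluster ω.1 v ∧ u ∈ openCluster ω.2 v).card : ℕ) : ℝ)⁻¹
                  ∂((sourcedDoubleCurrentLaw 3 n βc ({pFar K} ∆ {v}) ({0} ∆ {v})).prod
                    (sourcedDoubleCurrentLaw 3 n βc ({qFar K} ∆ {v}) ({e₂} ∆ {v}))) ≤
              C * ∑ v ∈ A, threePointRatio n (((2 : ℤ) ^ j) • y 0) (((2 : ℤ) ^ j) • y 1) v *
                  threePointRatio n (((2 : ℤ) ^ j) • y 2) (((2 : ℤ) ^ j) • y 3) v *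
                ∫ ω, (((A.filter fun u => u ∈ openCluster ω.1 v ∧ u ∈ openCluster ω.2 v).card : ℕ) : ℝ)⁻¹
                  ∂((sourcedDoubleCurrentLaw 3 n βc ({((2 : ℤ) ^ j) • y 1} ∆ {v}) ({((2 : ℤ) ^ j) • y 0} ∆ {v})).prod
                    (sourcedDoubleCurrentLaw 3 n βc ({((2 : ℤ) ^ j) • y 3} ∆ {v}) ({((2 : ℤ) ^ j) • y 2} ∆ {v}))))
    (θ : ℝ) (hθ : 0 < θ) :
    ∃ M k₁ : ℕ, ∃ C : ℝ, ∃ ε : ℕ → ℝ, Tendsto ε atTop (nhds 0) ∧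
      ∀ k K : ℕ, 1 ≤ k → k ≤ 5 * K + 3 → Doubling θ K → Doubling θ k → ∀ᶠ n : ℕ in atTop, ∀ c : ℝ,
        (∀ y : Fin 4 → Site 3, Function.Injective y → (∀ i, y i ∈ box 3 M) →
            ∀ j : ℕ, k ≤ j + k₁ → j ≤ k + 2 → meet n (fun i => ((2 : ℤ) ^ j) • y i) ≤ c) →
          meetAnn n k K ≤ C * c + ε k := by
  obtain ⟨M, k₁, C, hC⟩ := hRD θ hθ
  refine ⟨M, k₁, max C 0 * M, fun _ => 0, tendsto_const_nhds, ?_⟩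
  intro k K hk hkK hDK hDk
  obtain ⟨P, hPcard, hcover, hsub, hdom⟩ := hC k K hk hkK hDK hDk
  choose! y hyinj hybox j hj₁ hj₂ hev using hdom
  have hall := (eventually_all_finset P).2 hev
  have hbox : ∀ᶠ n : ℕ in atTop, ∀ A ∈ P, ∀ i, ((2 : ℤ) ^ j A) • y A i ∈ box 3 n :=
    (eventually_all_finset P).2 fun A _ => eventually_all.2 fun i => eventually_mem_box _
  filter_upwards [hall, eventually_scales_le k K, hbox] with n hn hsc hbn
  intro c hc
  set Ann := box 3 (2 ^ k) \ box 3 (2 ^ (k - 1)) with hAnn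
  have hAnnbox : Ann ⊆ box 3 n := ann_subset_box hsc.1
  have hpin : ∀ i, pinch K i ∈ box 3 n := pinch_mem_box hsc.2
  -- `c ≥ 0`: the annulus is nonempty, so some piece `A ∈ P` exists and its shape has `0 ≤ meet ≤ c`
  obtain ⟨v₀, hv₀⟩ := ann_nonempty hk
  obtain ⟨A₀, hA₀, -⟩ := hcover v₀ hv₀
  have hc0 : 0 ≤ c := le_trans measureReal_nonneg (hc (y A₀) (hyinj A₀ hA₀) (hybox A₀ hA₀) (j A₀) (hj₁ A₀ hA₀) (hj₂ A₀ hA₀))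
  have hC0 : 0 ≤ max C 0 := le_max_right _ _
  -- the pinch term and its nonnegativity
  have hρ : ∀ v ∈ Ann, 0 ≤ threePointRatio n 0 (pFar K) v * threePointRatio n e₂ (qFar K) v := fun v hv =>
    (mul_pos (threePointRatio_pos (hpin 0) (hpin 1) (hAnnbox hv)) (threePointRatio_pos (hpin 2) (hpin 3) (hAnnbox hv))).le
  have hE : ∀ (B : Finset (Site 3)) (v : Site 3) (μ : Measure (BondConfig (Site 3) × BondConfig (Site 3))),
      0 ≤ ∫ ω, (((B.filter fun u => u ∈ openCluster ω.1 v ∧ u ∈ openCluster ω.2 v).card : ℕ) : ℝ)⁻¹ ∂μ :=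
    fun B v μ => integral_nonneg fun ω => (invCount_mem_Icc B v v ω).1
  -- step 1–2: identity, cover, and monotonicity of the counting set
  rw [meetAnn_eq_sum_reroot hsc.1 hsc.2]
  refine (sum_le_sum_sum_of_cover Ann P _ (fun v hv => mul_nonneg (hρ v hv) (hE _ _ _)) hcover hsub).trans ?_
  have step : ∀ A ∈ P, ∑ v ∈ A, threePointRatio n 0 (pFar K) v * threePointRatio n e₂ (qFar K) v *
      ∫ ω, (((Ann.filter fun u => u ∈ openCluster ω.1 v ∧ u ∈ openCluster ω.2 v).card : ℕ) : ℝ)⁻¹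
        ∂((sourcedDoubleCurrentLaw 3 n βc ({pFar K} ∆ {v}) ({0} ∆ {v})).prod
          (sourcedDoubleCurrentLaw 3 n βc ({qFar K} ∆ {v}) ({e₂} ∆ {v}))) ≤ max C 0 * c := by
    intro A hA
    have hAbox : A ⊆ box 3 n := (hsub A hA).trans hAnnbox
    set Y : Fin 4 → Site 3 := fun i => ((2 : ℤ) ^ j A) • y A i with hYdef
    have hY : ∀ i, Y i ∈ box 3 n := hbn A hA
    haveI : IsProbabilityMeasure (fourTraceLaw n Y) := TailTightnessProof.isProbabilityMeasure_fourTraceLaw hY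
    have hfresh : 0 ≤ ∑ v ∈ A, threePointRatio n (Y 0) (Y 1) v * threePointRatio n (Y 2) (Y 3) v *
        ∫ ω, (((A.filter fun u => u ∈ openCluster ω.1 v ∧ u ∈ openCluster ω.2 v).card : ℕ) : ℝ)⁻¹
          ∂((sourcedDoubleCurrentLaw 3 n βc ({Y 1} ∆ {v}) ({Y 0} ∆ {v})).prod
            (sourcedDoubleCurrentLaw 3 n βc ({Y 3} ∆ {v}) ({Y 2} ∆ {v}))) :=
      Finset.sum_nonneg fun v hv => mul_nonneg (mul_pos (threePointRatio_pos (hY 0) (hY 1) (hAbox hv))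
        (threePointRatio_pos (hY 2) (hY 3) (hAbox hv))).le (hE _ _ _)
    calc _ ≤ ∑ v ∈ A, threePointRatio n 0 (pFar K) v * threePointRatio n e₂ (qFar K) v *
          ∫ ω, (((A.filter fun u => u ∈ openCluster ω.1 v ∧ u ∈ openCluster ω.2 v).card : ℕ) : ℝ)⁻¹
            ∂((sourcedDoubleCurrentLaw 3 n βc ({pFar K} ∆ {v}) ({0} ∆ {v})).prod
              (sourcedDoubleCurrentLaw 3 n βc ({qFar K} ∆ {v}) ({e₂} ∆ {v}))) := by
          refine Finset.sum_le_sum fun v hv => mul_le_mul_of_nonneg_left ?_ (hρ v (hsub A hA hv))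
          haveI : IsProbabilityMeasure (sourcedDoubleCurrentLaw 3 n βc ({pFar K} ∆ {v}) ({0} ∆ {v})) :=
            isProbabilityMeasure_law₂ (hpin 1) (hAnnbox (hsub A hA hv)) (hpin 0) (hAnnbox (hsub A hA hv))
          haveI : IsProbabilityMeasure (sourcedDoubleCurrentLaw 3 n βc ({qFar K} ∆ {v}) ({e₂} ∆ {v})) :=
            isProbabilityMeasure_law₂ (hpin 3) (hAnnbox (hsub A hA hv)) (hpin 2) (hAnnbox (hsub A hA hv))
          exact integral_invCount_anti (hsub A hA) hv _
      _ ≤ max C 0 * ∑ v ∈ A, threePointRatio n (Y 0) (Y 1) v * threePointRatio n (Y 2) (Y 3) v *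
          ∫ ω, (((A.filter fun u => u ∈ openCluster ω.1 v ∧ u ∈ openCluster ω.2 v).card : ℕ) : ℝ)⁻¹
            ∂((sourcedDoubleCurrentLaw 3 n βc ({Y 1} ∆ {v}) ({Y 0} ∆ {v})).prod
              (sourcedDoubleCurrentLaw 3 n βc ({Y 3} ∆ {v}) ({Y 2} ∆ {v}))) :=
          (hn A hA).trans (mul_le_mul_of_nonneg_right (le_max_left _ _) hfresh)
      _ = max C 0 * (fourTraceLaw n Y).real {ω | ∃ u ∈ A, u ∈ openCluster ω.1 (Y 0) ∧ u ∈ openCluster ω.2 (Y 2)} := by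
          rw [real_meetSet_eq_sum_reroot hY hAbox]
      _ ≤ max C 0 * meet n Y := by
          refine mul_le_mul_of_nonneg_left (measureReal_mono (fun ω hω => ?_) (measure_ne_top _ _)) hC0
          obtain ⟨u, -, hu1, hu2⟩ := hω
          exact ⟨u, hu1, hu2⟩
      _ ≤ max C 0 * c := mul_le_mul_of_nonneg_left (hc (y A) (hyinj A hA) (hybox A hA) (j A) (hj₁ A hA) (hj₂ A hA)) hC0
  calc _ ≤ ∑ A ∈ P, max C 0 * c := Finset.sum_le_sum step
    _ = P.card * (max C 0 * c) := by rw [Finset.sum_const, nsmul_eq_mul]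
    _ ≤ M * (max C 0 * c) := mul_le_mul_of_nonneg_right (by exact_mod_cast hPcard) (mul_nonneg hC0 hc0)
    _ = max C 0 * M * c + 0 := by ring

end MeetDominationProof

open MeasureTheory Filter
open scoped symmDiff
open Literature.Probability.LatticeModels Literature.Probability.Percolation
open Summit.CriticalPhenomena.Ising3DConformalLimit.GapForcesFarMergingSandwich
open Summit.CriticalPhenomena.Ising3DConformalLimit.Cruxes.IsingEuclidUpgradeR4NonGaussian.FreeCovarianceDeltaDichotomy
  (threePointRatio)

open Classical in
/-- **Registered helper `meetDomination_rerootIdentity`** (exact re-rooting identity for the annulus-meeting probability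
of the one-pinch system): for `2^k, 2^K ≤ n`,
`meetAnn n k K = ∑_{v ∈ Λ_{2^k}∖Λ_{2^{k-1}}} ρ_n(0,p_K;v) ρ_n(e₂,q_K;v) · E^{P^{p_Kv,0v}⊗P^{q_Kv,e₂v}}[1/#(C₁(v) ∩ C₂(v) ∩ (Λ_{2^k}∖Λ_{2^{k-1}}))]`.
[cite: AizenmanDuminilCopinAnnals2021, §4.1–4.2, proof of Thm 1.3 and Lemma 4.4] -/
theorem meetDomination_rerootIdentity : ∀ (n k K : ℕ), 2 ^ k ≤ n → 2 ^ K ≤ n → meetAnn n k K = ∑ v ∈ box 3 (2 ^ k) \ box 3 (2 ^ (k - 1)), threePointRatio n 0 (pFar K) v * threePointRatio n e₂ (qFar K) v * ∫ ω, ((((box 3 (2 ^ k) \ box 3 (2 ^ (k - 1))).filter fun u => u ∈ openCluster ω.1 v ∧ u ∈ openCluster ω.2 v).card : ℕ) : ℝ)⁻¹ ∂((sourcedDoubleCurrentLaw 3 n βc ({pFar K} ∆ {v}) ({0} ∆ {v})).prod (sourcedDoubleCurrentLaw 3 n βc ({qFar K} ∆ {v}) ({e₂} ∆ {v}))) :=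
  fun _ _ _ hk hK => MeetDominationProof.meetAnn_eq_sum_reroot hk hK

end Summit.CriticalPhenomena.Ising3DConformalLimit.EnergyNotSigmaSquaredGapForcesFarMergingSandwich

end
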